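import Summits.QuantumFields.YangMills.Theorems.PencilRigidityDiagonalMirrorRPRReduction

/-!
# Line `centre-twisted-swap` — crux `DiagonalMirrorRPR` (stmt-QuantumFields-10604) — skeleton

Crux (shared VERBATIM by `Theses/PencilRigidity.lean` #5 and `Theses/MirrorModularBoosts.lean` #4, `shared_verbatim`):

  for every compact simple `G`, `r`, `sch`, one-species family `S₁` with the curvature package `W₁ r sch S₁`
  (`CurvaturePackage`), `S₁` is reflection positive in pull-back form in the four diagonal frames (`DiagonalFrameRP`).

**The idea (`Ideas/centre-twisted-swap.md`, triage r2-1/r2-2: pass).**  On the Fröhlich–Israel–Lieb–Simon 45° torus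
`T̃_N` the swap reflection positivity of Wilson's measure (landed S1 `stub_fortyFiveSwapRP`, `β ≥ 0`) rests on the
diagonal Schur cut of the `(0,1)`-plaquettes based on the two mirror layers, `U_p = P₊ · (P₊ ∘ θ^*)⁻¹`, which is
cone-positive only for `β ≥ 0` (`Disproof` §5(a) `twoSpin_pairing_neg_of_neg`).  If the gauge group has a central
element `z` with `ρ(z) = −𝟙`, dress the reflection with the CENTRE TWIST `C_z` (every `e₁`-link variable multiplied by
`z`): `Θ'_z U = C_z (θ^* U)`, i.e. `(Θ'_z U)(e) = z^{[e is an e₁-edge]} · U(swapEdge e)` (`twistSwapConfig`).  Then at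
both layers `P₊(Θ'_z U) = z · P₋(U)` (exactly one `e₁`-link in `P₊`), so
`exp(β Re tr ρ(U_p)) = exp(|β| Re tr[ρ(P₊(U)) ρ(P₊(Θ'_z U))†])` for `β < 0` — the SAME Gram kernel as at coupling `|β|`;
`A₋ = A₊ ∘ Θ'_z` because every plaquette carries its `e₁`-links in a cancelling pair (`z` central); the shared
`e₂,e₃`-links of the layers are `Θ'_z`-fixed; and `(Θ'_z U)|pos` is a Haar-preserving image of `U|neg` (left
translation by `z` on some coordinates ∘ relabelling), so the tree engine
`LatticeRP.integral_mul_conj_mul_exp_nonneg_of_shared` applies verbatim (it needs no involutivity of the reflection).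
Hence Wilson's measure on `T̃_N` is `Θ'_z`-reflection positive for EVERY `β ≤ 0`, `N ≥ 2`, on ALL bounded measurable
observables of the closed positive half (`stub_twistedSwapRP`, S1').  The closure step S4' feeds the cover RP only
products of smeared curvature fields (`coverField`), which are functions of plaquette holonomies and therefore
EXACTLY `C_z`-invariant, so for them `Θ'_z`-RP is plain swap-RP: the closure goes through from the twisted
hypothesis with no sign condition (`stub_rpClosureTwisted`, S4'' — the landed S4' proof with one invariance lemma).
Net effect on the crux: for lattice data `(G, r)` with `−𝟙 ∈ r.ρ(Z(G))` (`SU(2n)`, `Sp(n)`, spinorial `Spin`, `E₇`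
with their faithful irreducible `ρ`) the sign clause `∀ᶠ k, 0 ≤ β_k` of the other line disappears; what remains
is the transport residual, now sign-free for centre data (`stub_coverTransportCentre`, T_c) next to the shared
residual for eventually non-negative couplings (`stub_coverTransportOffDiag`, T, VERBATIM the registered stub of line
`parity-bridge-cold-traces`), and the scope stub shrinks to centre-blind data with `β_k < 0` frequently
(`stub_centreBlindNegativeScope`, N': `SU(2n+1)`, `G₂`, `F₄`, `E₆`, `E₈`, centre-blind `ρ` — the uncontrolled
frustrated model of `Disproof` §10, no lever).

**Composition (kernel-checked, no `sorry`).**  `DiagonalMirrorRPR_of : TwistedSwapRP → RPClosureTwisted →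
CoverTransportOffDiag → CoverTransportCentre → CentreBlindNegativeScope → crux`:  given `G` simple, `r, sch, S₁`, `W₁`:
(centre data) T_c gives cover insensitivity; at each `k` with `N_k ≥ 2` the cover is `Θ'_1 = θ^*`-RP if `β_k ≥ 0`
(landed S1) and `Θ'_z`-RP if `β_k ≤ 0` (S1'); S4'' closes.  (centre-blind, `β_k ≥ 0` eventually) T gives cover
insensitivity and the LANDED `Reduction.diagonalFrameRP_of_coverInsensitivityOffDiag` (tail shift + S1 + S4') closes.
(centre-blind, `β_k < 0` frequently) N'.  Corollary (`diagonalFrameRP_of_coverConvergence_centre`, sorry-free given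
S1' and S4''): the recommended RESTATED crux (`W₁ ∧ sign ∧ cover convergence ⇒ DiagonalFrameRP`,
`Reduction.restatedCrux_holds`) holds with its sign clause weakened to `(∃ z ∈ Z(G), r.ρ z = −𝟙) ∨ ∀ᶠ k, 0 ≤ β_k`.

**Disproof items honoured.**  §5(a) `twoSpin_pairing_neg_of_neg` — ANSWERED on the cover for centre data (the twist
flips exactly the offending sign; plain swap-RP at `β < 0` stays false on gauge-variant `F`, triage r2-2 witness
`tr P₊`, pairing `−β/2`, which is why S1' is stated with `Θ'_z` for all `F` and NOT as `CoverSwapRPAt ρ β N`);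
§6/§8 `Phantom.cruxWithoutLatticeConvergence_false` (= `Negative/HconvLoadBearing`: any proof must use `hconv` on
`𝒩`) — `hconv` is used in all degrees inside S4''/S4' (entry convergence of the lattice Gram forms); §4
`Negative/SquareTorusNotSwapRP` — no square-torus RP is asserted anywhere (all RP upstairs is on `T̃_N`, `N ≥ 2`);
§9 `Negative/L1GaussianNotDiagonalRP` — the line is action-specific (Schur cut of Wilson's plaquette weight, plus a
centre element represented by `−𝟙`); §10 `Negative/OddTorusTwist` — respected and explained: on the ODD torus a
single unpaired centre grading survives (`Z(T_N, β<0) = Tr(𝕋̂ᴺ C_z)`), which is why the cut is made on the cover and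
the odd torus is only ever reached through transport (T_c), never through an odd-geometry cut; `ledger negatives`
(the misstated first filing `DiagonalMirrorRP`, `S₁ 0` free) — untouched (E0 ∈ `W₁`).

References: Fröhlich–Israel–Lieb–Simon, Comm. Math. Phys. 62 (1978) Thm 2.1; FILS II, J. Stat. Phys. 22 (1980) §3;
Osterwalder–Seiler, Ann. Phys. 110 (1978) §2; 't Hooft, Nucl. Phys. B153 (1979) 141 (twisted b.c., centre flux);
Borgs–Seiler, Comm. Math. Phys. 91 (1983) 329 (twist free energies in the confining phase).
-/

set_option autoImplicit false

noncomputable section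

open scoped SchwartzMap ComplexConjugate
open MeasureTheory Filter Topology
open Literature.MathematicalPhysics.QuantumLattice Literature.MathematicalPhysics.AQFT
  Literature.MathematicalPhysics.QuantumFieldTheory

namespace Summit.QuantumFields.YangMills.Cruxes.DiagonalMirrorRPR.CentreTwistedSwap

open ParityBridgeColdTraces

/-! ## §0 Readback of the crux (vocabulary VERBATIM from `Theorems/PencilRigidityDiagonalMirrorRPRStubRpClosureDefs`,
`…StubRpClosureOffDiag`: `E4`, `CurvaturePackage`, `DiagonalFrameRP`, `TConfig`, `swapEdge`, `swapConfig`, `posEdges`,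
`texp`, `CoverSwapRPAt`, `coverSchwinger`, `CoverInsensitivityOffDiag`) -/

/-- Readback: the crux (the item's recorded decl, the `MirrorModularBoosts` copy) is definitionally
`∀ G simple, r, sch, S₁: CurvaturePackage → DiagonalFrameRP`. -/
theorem crux_iff :
    Summit.QuantumFields.YangMills.Theses.MirrorModularBoosts.DiagonalMirrorRPR ↔
      ∀ (G : Type) [Group G] [TopologicalSpace G] [IsTopologicalGroup G] [CompactSpace G],
        IsCompactSimpleLieGroup G →
          letI : MeasurableSpace G := borel G
          haveI : BorelSpace G := ⟨rfl⟩
          ∀ (r : LatticeRep G) (sch : SpeciesScheme (YMSpecies G)) (S₁ : SchwingerFamily E4),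
            CurvaturePackage r sch S₁ → DiagonalFrameRP S₁ :=
  Iff.rfl

/-- The two route copies are the same proposition. -/
theorem shared_verbatim :
    Summit.QuantumFields.YangMills.Theses.PencilRigidity.DiagonalMirrorRPR ↔
      Summit.QuantumFields.YangMills.Theses.MirrorModularBoosts.DiagonalMirrorRPR := Iff.rfl

/-! ## §1 The centre twist and the twisted swap reflection on the 45° torus -/

section Twist

variable {N : ℕ} {G : Type*} [Group G]

/-- The centre twist `C_z`: every `e₁`-edge variable multiplied on the left by `z`.  For central `z` it leaves every
plaquette holonomy, hence Wilson's action and every gauge-invariant function of plaquettes, unchanged; it is NOT a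
gauge transformation of `T̃_N` (a loop winding the `w`-circle once meets `N` `e₁`-edges, `z^N = z` for odd `N`). -/
def centreTwist (z : G) (U : TConfig (2 * N) N N G) : TConfig (2 * N) N N G :=
  fun e => (if e.2 = 1 then z else 1) * U e

/-- The twisted swap `Θ'_z = C_z ∘ θ^*`: `(Θ'_z U)(e) = z^{[e is an e₁-edge]} · U(swapEdge e)`. -/
def twistSwapConfig (z : G) (U : TConfig (2 * N) N N G) : TConfig (2 * N) N N G :=
  fun e => (if e.2 = 1 then z else 1) * U (swapEdge e)

/-- `Θ'_z = C_z ∘ θ^*` (definitionally). -/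
theorem twistSwapConfig_eq (z : G) (U : TConfig (2 * N) N N G) :
    twistSwapConfig z U = centreTwist z (swapConfig U) := rfl

/-- The trivial twist is the plain swap: `Θ'_1 = θ^*`. -/
@[simp] theorem twistSwapConfig_one (U : TConfig (2 * N) N N G) : twistSwapConfig (1 : G) U = swapConfig U := by
  funext e
  simp only [twistSwapConfig, swapConfig, Function.comp_apply, ite_self, one_mul]

/-- The trivial centre twist is the identity. -/
@[simp] theorem centreTwist_one (U : TConfig (2 * N) N N G) : centreTwist (1 : G) U = U := by
  funext e
  simp only [centreTwist, ite_self, one_mul]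

/-- On an `e₁`-edge the centre twist multiplies by `z`. -/
@[simp] theorem centreTwist_apply_one (z : G) (U : TConfig (2 * N) N N G) (y : TSite (2 * N) N N) :
    centreTwist z U (y, 1) = z * U (y, 1) := by
  show (if (1 : Fin 4) = 1 then z else 1) * U (y, 1) = z * U (y, 1)
  rw [if_pos rfl]

/-- Off the `e₁`-edges the centre twist does nothing. -/
theorem centreTwist_apply_of_ne (z : G) (U : TConfig (2 * N) N N G) {k : Fin 4} (hk : k ≠ 1)
    (y : TSite (2 * N) N N) : centreTwist z U (y, k) = U (y, k) := by
  show (if k = 1 then z else 1) * U (y, k) = U (y, k)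
  rw [if_neg hk, one_mul]

end Twist

/-! ### Certificate: the centre twist is a symmetry of every plaquette holonomy (hence of Wilson's action)

This is the bookkeeping both triagers name as the cheapest falsifier of the idea ("every plaquette of the sheared 45°
torus has zero net `e₁`-charge"): kernel-checked here for central `z`, all sites, all direction pairs, every `N`. -/

section CentreInvariance

variable {N : ℕ} {G : Type*} [Group G] {z : G}

/-- `i = 1 ≠ j`: the two `e₁`-links of the plaquette are its first (forward) and third (inverse) factors. -/
private theorem twist_plaq_left (hz : ∀ g : G, g * z = z * g) (a b c d : G) :
    z * a * b * (z * c)⁻¹ * d⁻¹ = a * b * c⁻¹ * d⁻¹ := by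
  have h1 : z * a * b * (z * c)⁻¹ = a * b * c⁻¹ := by
    rw [mul_inv_rev, ← hz a, mul_assoc a z b, ← hz b, ← mul_assoc a b z, mul_assoc (a * b) z (c⁻¹ * z⁻¹),
      ← mul_assoc z c⁻¹ z⁻¹, ← hz c⁻¹, mul_inv_cancel_right]
  rw [h1]

/-- `i ≠ 1 = j`: the two `e₁`-links of the plaquette are its second (forward) and fourth (inverse) factors. -/
private theorem twist_plaq_right (hz : ∀ g : G, g * z = z * g) (a b c d : G) :
    a * (z * b) * c⁻¹ * (z * d)⁻¹ = a * b * c⁻¹ * d⁻¹ := by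
  rw [mul_inv_rev, ← hz b, ← mul_assoc a b z, mul_assoc (a * b) z c⁻¹, ← hz c⁻¹, ← mul_assoc (a * b) c⁻¹ z,
    mul_assoc (a * b * c⁻¹) z (d⁻¹ * z⁻¹), ← mul_assoc z d⁻¹ z⁻¹, ← hz d⁻¹, mul_inv_cancel_right]

/-- **Every plaquette holonomy of `T̃_N` is invariant under the centre twist** (central `z`; every site, every
direction pair — the `e₁`-links of a plaquette come as one forward and one inverse factor). -/
theorem tplaq_centreTwist (hz : z ∈ Subgroup.center G) (U : TConfig (2 * N) N N G) (x : TSite (2 * N) N N)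
    (i j : Fin 4) : tplaq true (centreTwist z U) x i j = tplaq true U x i j := by
  have hc : ∀ g : G, g * z = z * g := fun g => Subgroup.mem_center_iff.1 hz g
  unfold tplaq
  by_cases hi : i = 1 <;> by_cases hj : j = 1
  · subst hi; subst hj
    simp only [centreTwist_apply_one, mul_inv_cancel_right, mul_inv_cancel]
  · subst hi
    simp only [centreTwist_apply_one, centreTwist_apply_of_ne z U hj]
    exact twist_plaq_left hc _ _ _ _
  · subst hj
    simp only [centreTwist_apply_one, centreTwist_apply_of_ne z U hi]
    exact twist_plaq_right hc _ _ _ _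
  · simp only [centreTwist_apply_of_ne z U hi, centreTwist_apply_of_ne z U hj]

/-- **Wilson's action on `T̃_N` is invariant under the centre twist** (so `A₊ ∘ Θ'_z = A₊ ∘ θ^* = A₋`, and every
function of plaquette holonomies — in particular the curvature strings fed to the cover RP by S4'' — is
`C_z`-invariant). -/
theorem taction_centreTwist [NeZero N] {Nc : ℕ} (ρ : G →* Matrix (Fin Nc) (Fin Nc) ℂ)
    (hz : z ∈ Subgroup.center G) (U : TConfig (2 * N) N N G) :
    taction ρ true (centreTwist z U) = taction ρ true U := by
  simp only [taction, tplaq_centreTwist hz]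

/-- The Boltzmann weight is invariant under the centre twist, at every coupling of either sign. -/
theorem tweight_centreTwist [NeZero N] {Nc : ℕ} (ρ : G →* Matrix (Fin Nc) (Fin Nc) ℂ) (β : ℝ)
    (hz : z ∈ Subgroup.center G) (U : TConfig (2 * N) N N G) :
    tweight ρ β true (centreTwist z U) = tweight ρ β true U := by
  simp only [tweight, taction_centreTwist ρ hz]

end CentreInvariance

section TwistedRP

variable {G : Type} [Group G] [TopologicalSpace G] [IsTopologicalGroup G] [CompactSpace G]
  [MeasurableSpace G] [BorelSpace G] {Nc : ℕ}

/-- **`Θ'_z`-reflection positivity of Wilson's measure on `T̃_N` at `(ρ, β)`**: for every bounded measurable `F`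
depending only on the edges of the closed positive half, `⟨conj(F ∘ Θ'_z) · F⟩_β ≥ 0` (real and non-negative).
For `z = 1` this is `CoverSwapRPAt ρ β N` (`coverTwistedSwapRPAt_one_iff`). -/
def CoverTwistedSwapRPAt (ρ : G →* Matrix (Fin Nc) (Fin Nc) ℂ) (z : G) (β : ℝ) (N : ℕ) [NeZero N] : Prop :=
  ∀ F : TConfig (2 * N) N N G → ℂ, Measurable F → (∃ C : ℝ, ∀ U, ‖F U‖ ≤ C) →
    DependsOn F (posEdges N) →
      0 ≤ (texp ρ β true fun U => conj (F (twistSwapConfig z U)) * F U).re ∧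
        (texp ρ β true fun U => conj (F (twistSwapConfig z U)) * F U).im = 0

/-- Untwisted (`z = 1`) twisted RP is the plain swap-RP `CoverSwapRPAt` of the line `parity-bridge-cold-traces`. -/
theorem coverTwistedSwapRPAt_one_iff (ρ : G →* Matrix (Fin Nc) (Fin Nc) ℂ) (β : ℝ) (N : ℕ) [NeZero N] :
    CoverTwistedSwapRPAt ρ 1 β N ↔ CoverSwapRPAt ρ β N := by
  simp only [CoverTwistedSwapRPAt, CoverSwapRPAt, twistSwapConfig_one]

end TwistedRP

/-! ## §2 The stub statements (named `def … : Prop`, untagged: the composition `DiagonalMirrorRPR_of` takes them as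
hypotheses and therefore credits nothing; the hypothesis-free `DiagonalMirrorRPR_proof` is the skeleton theorem) -/

/-- Statement of `stub_twistedSwapRP` (S1'). -/
def TwistedSwapRP : Prop :=
  ∀ (G : Type) [Group G] [TopologicalSpace G] [IsTopologicalGroup G] [CompactSpace G]
    [MeasurableSpace G] [BorelSpace G] (Nc : ℕ) (ρ : G →* Matrix (Fin Nc) (Fin Nc) ℂ),
    Continuous ρ → (∀ g, ρ g ∈ Matrix.unitaryGroup (Fin Nc) ℂ) →
      ∀ z ∈ Subgroup.center G, ρ z = -1 →
        ∀ (β : ℝ), β ≤ 0 → ∀ (N : ℕ) [NeZero N], 2 ≤ N → CoverTwistedSwapRPAt ρ z β N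

/-- Statement of `stub_rpClosureTwisted` (S4''). -/
def RPClosureTwisted : Prop :=
  ∀ (G : Type) [Group G] [TopologicalSpace G] [IsTopologicalGroup G] [CompactSpace G]
    [MeasurableSpace G] [BorelSpace G], IsCompactSimpleLieGroup G →
    ∀ (r : LatticeRep G) (sch : SpeciesScheme (YMSpecies G)) (S₁ : SchwingerFamily E4),
      CurvaturePackage r sch S₁ →
        (∀ k, 2 ≤ sch.side k → ∃ z ∈ Subgroup.center G, CoverTwistedSwapRPAt r.ρ z (sch.β k) (sch.side k)) →
          CoverInsensitivityOffDiag r sch → DiagonalFrameRP S₁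

/-- Statement of `stub_coverTransportOffDiag` (T; VERBATIM the registered transport stub of line
`parity-bridge-cold-traces`, shared). -/
def CoverTransportOffDiag : Prop :=
  ∀ (G : Type) [Group G] [TopologicalSpace G] [IsTopologicalGroup G] [CompactSpace G]
    [MeasurableSpace G] [BorelSpace G], IsCompactSimpleLieGroup G →
    ∀ (r : LatticeRep G) (sch : SpeciesScheme (YMSpecies G)) (S₁ : SchwingerFamily E4),
      CurvaturePackage r sch S₁ → (∀ᶠ k in atTop, 0 ≤ sch.β k) → CoverInsensitivityOffDiag r sch

/-- Statement of `stub_coverTransportCentre` (T_c; the transport residual for centre data, no sign clause). -/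
def CoverTransportCentre : Prop :=
  ∀ (G : Type) [Group G] [TopologicalSpace G] [IsTopologicalGroup G] [CompactSpace G]
    [MeasurableSpace G] [BorelSpace G], IsCompactSimpleLieGroup G →
    ∀ (r : LatticeRep G) (sch : SpeciesScheme (YMSpecies G)) (S₁ : SchwingerFamily E4),
      CurvaturePackage r sch S₁ → (∃ z ∈ Subgroup.center G, r.ρ z = -1) → CoverInsensitivityOffDiag r sch

/-- Statement of `stub_centreBlindNegativeScope` (N'; scope stub, no lever). -/
def CentreBlindNegativeScope : Prop :=
  ∀ (G : Type) [Group G] [TopologicalSpace G] [IsTopologicalGroup G] [CompactSpace G]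
    [MeasurableSpace G] [BorelSpace G], IsCompactSimpleLieGroup G →
    ∀ (r : LatticeRep G) (sch : SpeciesScheme (YMSpecies G)) (S₁ : SchwingerFamily E4),
      CurvaturePackage r sch S₁ → (¬ ∃ z ∈ Subgroup.center G, r.ρ z = -1) → (∃ᶠ k in atTop, sch.β k < 0) →
        DiagonalFrameRP S₁

/-! ## §3 The registered stubs -/

/-- **S1' (M), `stub_twistedSwapRP` — twisted swap-RP of Wilson's measure on the 45° torus at non-positive
coupling.**  For every compact `G`, continuous unitary `ρ`, central `z` with `ρ z = −𝟙`, `β ≤ 0`, `N ≥ 2` and every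
bounded measurable `F` of the closed positive half `0 ≤ u ≤ N`: `⟨conj(F ∘ Θ'_z) · F⟩_β` is real and `≥ 0`, where
`Θ'_z U = C_z (θ^*U)` (`twistSwapConfig`).  Intended proof: the twin of the Literature theorem
`TiltedTorusRP.integral_conj_swap_mul_nonneg` (TiltedTorusSwapRP.lean, FILS 1978 Thm 2.1 on the tilted torus) with
`Θ := fun U e => (if e.2 = 1 then z else 1) * U (θ e)`: same blocks `M` (layer `e₂,e₃`-links, `Θ'_z`-fixed), `P`, `cut`,
`sh`, `pos`; `Θ'_z` is measure preserving (left translation by `z` on the `e₁`-coordinates ∘ the relabelling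
involution) and satisfies the engine's `hΘM`, `hΘdep`; every non-cut plaquette term is `C_z`-invariant (its `e₁`-links
come in a cancelling pair, `z` central), so `A₋ = A₊ ∘ Θ'_z` and the shared `(2,3)`-terms are untouched; on the cut,
`cl k (Θ'_z U) = z · (the opposite half-plaquette of U)`, hence with `ρ z = −𝟙` and unitarity
`β · Re tr ρ(U_p) = |β| · Re ∑_{ab} ρ(cl U)_{ab} conj ρ(cl (Θ'_z U))_{ab}` — the engine
`LatticeRP.integral_mul_conj_mul_exp_nonneg_of_shared` with `aᵢ = √(|β|/2) ·` (entries, conjugate entries);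
divide by `Z ≥ 0` as in `stub_fortyFiveSwapRP`.  Why plausibly true: exact identity, re-derived by both round-2
triagers; toy check (r2-2, 2D `ℤ₂` gauge theory on `T̃_3`, all 64 functions of the positive plaquettes): swap Gram
matrix PSD at `β = −1, −0.3` to `1e−14`.  NOT claimed (false): plain `CoverSwapRPAt ρ β N` at `β < 0`
(witness `F = tr ρ(P₊)`, `SU(2)`, pairing `−|β|/2 + O(β²)`). -/
theorem stub_twistedSwapRP :
    ∀ (G : Type) [Group G] [TopologicalSpace G] [IsTopologicalGroup G] [CompactSpace G]
      [MeasurableSpace G] [BorelSpace G] (Nc : ℕ) (ρ : G →* Matrix (Fin Nc) (Fin Nc) ℂ),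
      Continuous ρ → (∀ g, ρ g ∈ Matrix.unitaryGroup (Fin Nc) ℂ) →
        ∀ z ∈ Subgroup.center G, ρ z = -1 →
          ∀ (β : ℝ), β ≤ 0 → ∀ (N : ℕ) [NeZero N], 2 ≤ N → CoverTwistedSwapRPAt ρ z β N := by
  sorry

/-- **S4'' (M), `stub_rpClosureTwisted` — the OS-limit closure from TWISTED cover RP, no sign clause.**  Same
conclusion and the same proof as the landed S4' `stub_rpClosureOffDiag` (…StubRpClosureOffDiag: density of
slab-ordered compact real products, frame normal form, entry convergence by `hconv` + `CoverInsensitivityOffDiag`,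
closedness of `{Re ≥ 0, Im = 0}`), whose sign hypothesis `_hβ` is unused and whose RP hypothesis is invoked exactly
once, in `RpClosure.lattice_psd`, on the observables `A k I = ∏_l coverField r sch k (f_{I,l} ∘ R⁻¹)` of the closed
positive half.  The one new lemma: `coverField r sch k f (centreTwist z U) = coverField r sch k f U` for central `z`
(`coverField` = smeared `actionDensity r.ρ` of `skewLift U`; `skewLift (centreTwist z U)` is the centre twist of
`skewLift U` on `ℤ⁴`; every plaquette holonomy is unchanged because its `e₁`-links enter as `z·U` and `(z·U')⁻¹` with
`z` central; `plaquetteObs` is a function of the holonomy), whence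
`A k I (twistSwapConfig z U) = A k I (swapConfig U)` (`twistSwapConfig_eq`) and the twisted hypothesis yields the
plain Gram positivity `lattice_psd` needs.  Why plausibly true: bookkeeping over landed material; the class of `F`
the closure feeds is exactly the `C_z`-invariant one (triage r2-1 (ii), r2-2 §1). -/
theorem stub_rpClosureTwisted :
    ∀ (G : Type) [Group G] [TopologicalSpace G] [IsTopologicalGroup G] [CompactSpace G]
      [MeasurableSpace G] [BorelSpace G], IsCompactSimpleLieGroup G →
      ∀ (r : LatticeRep G) (sch : SpeciesScheme (YMSpecies G)) (S₁ : SchwingerFamily E4),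
        CurvaturePackage r sch S₁ →
          (∀ k, 2 ≤ sch.side k → ∃ z ∈ Subgroup.center G, CoverTwistedSwapRPAt r.ρ z (sch.β k) (sch.side k)) →
            CoverInsensitivityOffDiag r sch → DiagonalFrameRP S₁ := by
  sorry

/-- **T (XL, conjecture-class; SHARED VERBATIM with the registered `stub_coverTransportOffDiag` of line
`parity-bridge-cold-traces`) — cover transport at physical scale, eventually non-negative couplings.**  Along a
package-carrying scheme with `β_k ≥ 0` eventually, the curvature strings of pairwise-disjoint compactly supported real
families computed on the statement's odd torus `ℤ⁴/N_kℤ⁴` and on its 45° double cover have difference `→ 0`.  Both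
volumes are boundaryless, of physical size `≍ ℓ_k → ∞`, at the same coupling, in a phase that clusters uniformly
(`HasLatticeMassGap`), so local expectations should agree up to `O(e^{−Δℓ_k})`; not exported by `W₁` (no clause of
`W₁` compares two finite volumes at the same `k`: leads a1/c1, triage r2 Part B flat-band table) and not a theorem in
print beyond strong coupling (where limits are ultralocal and the conclusion holds anyway, `Disproof` §3).  The
mechanism of record for it is `Ideas/thermal-variance-transfer.md` ((V1)–(V3) + the Z-ratio residual (R1)∧(R2)). -/
theorem stub_coverTransportOffDiag :
    ∀ (G : Type) [Group G] [TopologicalSpace G] [IsTopologicalGroup G] [CompactSpace G]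
      [MeasurableSpace G] [BorelSpace G], IsCompactSimpleLieGroup G →
      ∀ (r : LatticeRep G) (sch : SpeciesScheme (YMSpecies G)) (S₁ : SchwingerFamily E4),
        CurvaturePackage r sch S₁ → (∀ᶠ k in atTop, 0 ≤ sch.β k) → CoverInsensitivityOffDiag r sch := by
  sorry

/-- **T_c (XL, conjecture-class; the hardest stub of this line) — cover transport at physical scale for CENTRE data,
no sign clause.**  For `(G, r)` with a central `z`, `r.ρ z = −𝟙`: along every package-carrying scheme the torus and
cover curvature strings of pairwise-disjoint compact real families have difference `→ 0`, whatever the signs of the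
`β_k`.  For `β_k ≥ 0` this is T restricted to centre data.  For `β_k < 0` it is the same finite-size statement for
the models that negative coupling really is: on every simply connected patch `β < 0 ≡ |β|` by the staggered centre
phases `U_{x,μ} ↦ z^{∑_{ν<μ} x_ν} U_{x,μ}` (curvature strings flip by `(−1)ⁿ`, counterterms `m ↦ −m`, identically on
both volumes), globally the odd torus is `|β|` with the maximal 't Hooft twist (`Negative/OddTorusTwist`,
`Disproof` §10) and the cover is `|β|` with a partial twist (the `(0,1)`-planes untwist: `t = x₀+x₁ mod 2` is
well defined on `T̃_N`) — so T_c at `β < 0` is twist-INSENSITIVITY of local `|β|`-correlators at physical scale in a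
uniformly clustering phase ('t Hooft 1979; Borgs–Seiler 1983: twist free energies vanish in the confining phase),
the same kind of open finite-size control as T, for the same reason not exported by `W₁`.  Why it might fail: a
centre-symmetry-breaking (deconfined-type) regime along the scheme would make twist sectors visible at physical
scale (`Literature.Barriers.QuantumFields.FiniteTemperatureDeconfinement` — not in class here since `ℓ_k → ∞` in all
four directions, but the bet is the standard confinement one). -/
theorem stub_coverTransportCentre :
    ∀ (G : Type) [Group G] [TopologicalSpace G] [IsTopologicalGroup G] [CompactSpace G]
      [MeasurableSpace G] [BorelSpace G], IsCompactSimpleLieGroup G →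
      ∀ (r : LatticeRep G) (sch : SpeciesScheme (YMSpecies G)) (S₁ : SchwingerFamily E4),
        CurvaturePackage r sch S₁ → (∃ z ∈ Subgroup.center G, r.ρ z = -1) → CoverInsensitivityOffDiag r sch := by
  sorry

/-- **N' (scope stub, outside every lever; STRICTLY NARROWER than the registered `stub_frequentlyNegativeCoupling`).**
Centre-blind lattice data (no central `z` with `r.ρ z = −𝟙`: `SU(2n+1)`, `G₂`, `F₄`, `E₆`, `E₈`, and centre-blind or
reducible `ρ` of the other groups) on schemes with `β_k < 0` for infinitely many `k`: no reflection-positive structure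
is known for Wilson's measure at `β < 0` (the diagonal Schur cut fails, `Disproof` §5(a); the fundamental character
coefficient of `exp(β Re tr U)` on `SU(3)` is `β/2 + O(β²) < 0`; no centre element flips the sign), and `β_k → −∞` is
a genuinely different, uncontrolled frustrated model (`Disproof` §10: for `SU(3)` the plaquettes want `U_p ∈ {ω, ω²}·𝟙`).
Recommended crux-level repair (disprover, all triagers, three leads): add `∀ᶠ k in atTop, 0 ≤ sch.β k` — or, with this
line, the weaker `(∃ z ∈ Subgroup.center G, r.ρ z = -1) ∨ ∀ᶠ k in atTop, 0 ≤ sch.β k` — to `W₁`, which makes this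
stub vacuous. -/
theorem stub_centreBlindNegativeScope :
    ∀ (G : Type) [Group G] [TopologicalSpace G] [IsTopologicalGroup G] [CompactSpace G]
      [MeasurableSpace G] [BorelSpace G], IsCompactSimpleLieGroup G →
      ∀ (r : LatticeRep G) (sch : SpeciesScheme (YMSpecies G)) (S₁ : SchwingerFamily E4),
        CurvaturePackage r sch S₁ → (¬ ∃ z ∈ Subgroup.center G, r.ρ z = -1) → (∃ᶠ k in atTop, sch.β k < 0) →
          DiagonalFrameRP S₁ := by
  sorry

/-! ## §4 Composition (kernel-checked, no `sorry`) -/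

section Composition

variable {G : Type} [Group G] [TopologicalSpace G] [IsTopologicalGroup G] [CompactSpace G]
  [MeasurableSpace G] [BorelSpace G]

/-- **Cover RP at every coupling for centre data.**  Given S1': for `(G, r)` with a central `z`, `r.ρ z = −𝟙`, every
cover `T̃_N`, `N ≥ 2`, is `Θ'`-RP at every real `β` for some central twist — the trivial one (`Θ'_1 = θ^*`, landed S1
`stub_fortyFiveSwapRP`) when `β ≥ 0`, `Θ'_z` (S1') when `β ≤ 0`. -/
theorem exists_coverTwistedSwapRPAt_of_centre (hS1' : TwistedSwapRP) (r : LatticeRep G) {z : G}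
    (hz : z ∈ Subgroup.center G) (hρz : r.ρ z = -1) (β : ℝ) (N : ℕ) [NeZero N] (hN : 2 ≤ N) :
    ∃ z' ∈ Subgroup.center G, CoverTwistedSwapRPAt r.ρ z' β N := by
  rcases le_total β 0 with hβ | hβ
  · exact ⟨z, hz, hS1' G r.N r.ρ r.continuous r.mem_unitary z hz hρz β hβ N hN⟩
  · exact ⟨1, Subgroup.one_mem _, (coverTwistedSwapRPAt_one_iff r.ρ β N).2
      (stub_fortyFiveSwapRP G r.N r.ρ r.continuous r.mem_unitary β hβ N hN)⟩

/-- **The centre branch.**  S1' + S4'': for centre data, the package and cover insensitivity (off-diagonal) give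
`DiagonalFrameRP S₁` with NO sign clause on the couplings. -/
theorem diagonalFrameRP_of_centre (hS1' : TwistedSwapRP) (hS4'' : RPClosureTwisted)
    (hG : IsCompactSimpleLieGroup G) (r : LatticeRep G) (sch : SpeciesScheme (YMSpecies G))
    (S₁ : SchwingerFamily E4) (hW : CurvaturePackage r sch S₁) (hz : ∃ z ∈ Subgroup.center G, r.ρ z = -1)
    (hCI : CoverInsensitivityOffDiag r sch) : DiagonalFrameRP S₁ := by
  obtain ⟨z, hzc, hρz⟩ := hz
  exact hS4'' G hG r sch S₁ hW (fun k hk => exists_coverTwistedSwapRPAt_of_centre hS1' r hzc hρz _ _ hk) hCI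

/-- **Corollary for the planners' restatement.**  Given S1' and S4'' (both M-sized and provable now): the curvature
package, the WEAKENED sign clause `(∃ z ∈ Z(G), r.ρ z = −𝟙) ∨ ∀ᶠ k, 0 ≤ β_k` and lattice convergence on the 45°
covers imply `DiagonalFrameRP S₁` — the closing theorem `Reduction.diagonalFrameRP_of_coverConvergence` of the
recommended restated crux with its sign hypothesis weakened at zero cost downstream. -/
theorem diagonalFrameRP_of_coverConvergence_centre (hS1' : TwistedSwapRP) (hS4'' : RPClosureTwisted)
    (hG : IsCompactSimpleLieGroup G) (r : LatticeRep G) (sch : SpeciesScheme (YMSpecies G))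
    (S₁ : SchwingerFamily E4) (hW : CurvaturePackage r sch S₁)
    (hsign : (∃ z ∈ Subgroup.center G, r.ρ z = -1) ∨ ∀ᶠ k in atTop, 0 ≤ sch.β k)
    (hcc : ∀ (n : ℕ), n ≠ 0 → ∀ (f : Fin n → 𝓢(E4, ℝ)) (F : 𝓢((Fin n → E4), ℂ)),
      IsTensorOf F (fun i => ofRealTest (f i)) → IsOffDiagonal F →
        Tendsto (fun k : ℕ => ((coverSchwinger r sch k n f : ℝ) : ℂ)) atTop (𝓝 (S₁ n F))) :
    DiagonalFrameRP S₁ := by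
  rcases hsign with hz | hev
  · exact diagonalFrameRP_of_centre hS1' hS4'' hG r sch S₁ hW hz
      (Reduction.coverInsensitivityOffDiag_of_coverConvergence r sch S₁ hW hcc)
  · exact Reduction.diagonalFrameRP_of_coverConvergence hG r sch S₁ hW hev hcc

end Composition

/-- **The line concludes the crux** (`PencilRigidity` copy; the five stub STATEMENTS as named hypotheses).
Centre data: T_c, then S1/S1' per `k`, then S4''.  Centre-blind data with `β_k ≥ 0` eventually: T, then the LANDED
reduction `Reduction.diagonalFrameRP_of_coverInsensitivityOffDiag` (tail shift + S1 + S4').  Centre-blind data with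
`β_k < 0` frequently: N'. -/
theorem DiagonalMirrorRPR_of (hS1' : TwistedSwapRP) (hS4'' : RPClosureTwisted) (hT : CoverTransportOffDiag)
    (hTc : CoverTransportCentre) (hN : CentreBlindNegativeScope) :
    Summit.QuantumFields.YangMills.Theses.PencilRigidity.DiagonalMirrorRPR := by
  refine shared_verbatim.mpr (crux_iff.mpr ?_)
  intro G _ _ _ _ hG
  letI : MeasurableSpace G := borel G
  haveI : BorelSpace G := ⟨rfl⟩
  intro r sch S₁ hW
  by_cases hz : ∃ z ∈ Subgroup.center G, r.ρ z = -1
  · exact diagonalFrameRP_of_centre hS1' hS4'' hG r sch S₁ hW hz (hTc G hG r sch S₁ hW hz)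
  · by_cases hev : ∀ᶠ k in atTop, 0 ≤ sch.β k
    · exact Reduction.diagonalFrameRP_of_coverInsensitivityOffDiag hG r sch S₁ hW hev (hT G hG r sch S₁ hW hev)
    · have hneg : ∃ᶠ k in atTop, sch.β k < 0 := by
        simpa only [Filter.not_eventually, not_le] using hev
      exact hN G hG r sch S₁ hW hz hneg

/-- **Skeleton theorem** (hypothesis-free: the composition applied to the registered stubs; it becomes the crux proof
when the last stub is discharged).  It concludes the item's recorded decl, the `MirrorModularBoosts` copy of the crux
(shared VERBATIM with the `PencilRigidity` copy, `shared_verbatim`). -/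
theorem DiagonalMirrorRPR_proof :
    Summit.QuantumFields.YangMills.Theses.MirrorModularBoosts.DiagonalMirrorRPR :=
  shared_verbatim.mp (DiagonalMirrorRPR_of stub_twistedSwapRP stub_rpClosureTwisted stub_coverTransportOffDiag
    stub_coverTransportCentre stub_centreBlindNegativeScope)

end Summit.QuantumFields.YangMills.Cruxes.DiagonalMirrorRPR.CentreTwistedSwap

end
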